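import Summits.Ventures.PercRepro.S1LadderCells

/-!
# PercRepro — THE CELL `(9, 13)` OF THE `q = 4` WINDOW (p2, gen 21; SUBCLAIM-S1 §6.5)

The last open cell of the row `p = 9` at `d ≥ 13` (`1.0207` at p8's `avgChain16`), by the COLOOP LADDER (S1LadderCells):
the coloop-free part takes the last averaging step at its own point count — `s₃ ≤ 33`, `s₄ ≤ ⌊22·326/18⌋ = 398`,
`s₅ ≤ ⌊22·3128/17⌋ = 4048` on `22` points, `0.9754` (the cell needs `s₄ ≤ 399` at the chain's `s₅`); one or two coloops
read `0.27 / 0.20` with the credit `2^{21} − W₃⁺(21)` (…); `c ≥ 3` coloops are the lossy ladder (`2(2^3 − 1) = 14 ≥ Φ(9, 4) = 8.4`).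
Exact-rational twin mining/p2/g21/gencells.py. The row `p = 9` of the `q = 4` window now ends at `(9, 12)`.

* `phiK_nine_four_le` — `Φ(9, 4) ≤ 14`; **`c025_core_nine_thirteen`**.
Axioms: standard.
-/

open scoped Matroid

namespace PercRepro

namespace S1

open Set

variable {α : Type}

/-- `Φ(9, 4) = 42/5 ≤ 14`. -/
theorem phiK_nine_four_le : phiK 9 4 ≤ 2 * ((2 : ℚ) ^ 3 - 1) := by
  simp only [phiK]
  rw [show Finset.Ioo 4 9 = {5, 6, 7, 8} by decide]
  norm_num [Finset.sum_insert, Finset.sum_singleton, Finset.sum_div, Nat.choose]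

/-- **THE CELL `(9, 13)`**: an `e`-free core of rank `9` with `22` points satisfies `RLS` at level `4` — by the
coloop ladder: `c = 0 … 2` coloops by the exact ladder on the lever caps, `c ≥ 3` by the lossy ladder. -/
theorem c025_core_nine_thirteen (M : Matroid α) [M.Finite] (hR : M.eRank = (9 : ℕ)) (hn : M.E.ncard = 22)
    (hfree : ∀ e ∈ M.E, ∃ A ⊆ M.E \ {e}, e ∉ M.closure A ∧ e ∉ M.closure ((M.E \ {e}) \ A)) :
    ThmN.RLS M 9 4 := by
  rcases (show M.coloops.ncard = 0 ∨ M.coloops.ncard = 1 ∨ M.coloops.ncard = 2 ∨ 3 ≤ M.coloops.ncard by omega) with h | h | h | h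
  · exact rls_of_ladder_case M (p := 9) (c := 0) (d := 13) (by norm_num) (by norm_num) hR hn hfree h
      (by norm_num) (by norm_num) (P := 33) (S := 398) (S5 := 4048) (by decide) (by decide) (by decide)
      (by decide +kernel)
  · exact rls_of_ladder_case M (p := 8) (c := 1) (d := 13) (by norm_num) (by norm_num) hR hn hfree h
      (by norm_num) (by norm_num) (P := 33) (S := 402) (S5 := 4105) (by decide) (by decide) (by decide)
      (by decide +kernel)
  · exact rls_of_ladder_case M (p := 7) (c := 2) (d := 13) (by norm_num) (by norm_num) hR hn hfree h
      (by norm_num) (by norm_num) (P := 34) (S := 407) (S5 := 4170) (by decide) (by decide) (by decide)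
      (by decide +kernel)
  · exact rls_of_coloops_lossy M (p := 6) (c := 3) (hR.trans (by norm_num)) (by norm_num) h phiK_nine_four_le

end S1

end PercRepro
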